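import Summits.Ventures.HSemireg.Pad4TowerFCCoreParitySeam

/-!
# Venture HSemireg — PAD-4 on 𝔅(μ₄): KERNEL RESULT 14 WITH SIGNS — the quantitative parity form on axis cells, the SIGNED
# presence of the FC core for positive multiplicities (weight 0 with sign `s` AND weight 2 with sign `−s`; weight 1 with `t` AND
# weight 3 with `−t`), and the `G₁ = ⟨Δ⟩ × S₄`-intrinsic ORBIT SIGN of even-weight fully charged classes

HONEST FRAMING. Lean index of the computation cell `pub-hsemireg` (S4-PUSH, H2 door PAD-4), written by the cell's second-code engine
`gs-eng-2` (g52; line of record stmt-HodgeConjecture-18881 `Cruxes/BlochSeedDiscOne/Lines/birth.lean` 814a6a70c14e831a, stub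
`stub_rung_pad4_seedAt`, screen (H1) = the class condition (A1)). Sequel of the gs-eng-2 kernel rows 840 `Pad4FCCore` (p588880: `8·x_κ =
Re(μ·i^{−|κ|})` pattern by pattern), 843 ∕ 872 (parity form) and of typer-2 g5's (J) `Pad4TowerFCCoreParitySeam` (the seam: on AXIS cells
(F)'s aggregate `MConfig.xPat` IS the parity aggregate `X_ρ`, so 840 applies to every weighted 𝔅(μ₄) configuration) and (K)
`Pad4TowerCleanCellOrbits` (orbit forms WITHOUT signs); §1–§2 were typed INDEPENDENTLY AND IN PARALLEL by typer-2 g5 as (L)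
`Pad4TowerFCCoreOrientedSigns.lean` v1 f0ff45ae9c6f4ac9 (`xPat_values_of_classScreen`, `oriented_signs_even∕odd_of_classScreen`, `HasFCSign`; cell INBOX
l.32202 ∕ l.32204), withdrawn in favour of this file under D-0071 (one row, not two). THIS FILE adds the SIGNS that (J) ∕ (K) declare out of scope («the SIGN refinements
of RESULT 14 ∕ 15 (3) (orbit signs ± sign Re μ) … not here»; gs-eng-2 g52 remark R1 on (K), cell INBOX l.32197), i.e. gs-eng-2 g51's
RESULT 14 VERBATIM (cell INBOX l.31979: «FC-CORE on the G₁ = Δ×S₄ cell: even core = one FC orbit of weight type {0,4} with sign + sign Re μ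
AND one of type {2} with the OPPOSITE sign; odd core = one orbit of type {1,3}») — the exact (H1)-side presence family «FC-CORE» that the
◇₈-G₁ encoder carries (xres2s v19, gs-eng-2 ×2 64e5460f3cbb3fe5) and that director-hodge g13's attribution batch R13.2 (4) isolates (V1 =
STATIC + FC-CORE). It is therefore the (H1) half of any «LINE 5» seed sentence of the form «a static-clean G₁-closed support cannot hang FC
orbits of weight classes {0,4} and {2} with opposite signs» (bc5-plan g6 l.32144; R13.2 (4)): the static half is NOT here.

CONTENT (all PROVED; no `sorry`; axioms standard).
* §1 THE QUANTITATIVE PARITY FORM ON AXIS CELLS: `MConfig.eight_xPat_re ∕ _im` — under (A1), for every configuration whose fully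
  charged classes are axis cells and every integer multiplicity vector, `8·xPat κ = +Re wch(ēēēē)` at `κ ∈ {0000, 1111}`, `= −Re wch(ēēēē)`
  at the six weight-2 patterns, `= +Im wch(ēēēē)` at the four weight-1 patterns, `= −Im wch(ēēēē)` at the four weight-3 patterns (840's
  `fcCore_κ` through (J)'s `mixedRowsVanish_of_classScreen_axis` + `mu_fcCore_axis`, cast back to `ℤ`).
* §2 SIGNED PRESENCE for POSITIVE multiplicities: `exists_signed_of_xPat_pos ∕ _neg` (a positive∕negative aggregate has a term of that
  sign: a LOWER class with `cprod` of that sign or an UPPER class with `cprod` of the opposite sign), and the headline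
  **`MConfig.signed_fcCore_of_classScreen`**: (A1) + `wch(eeee) ≠ 0` + `m ≥ 1` ⇒ EITHER (even core, `s := sign Re wch(ēēēē) ≠ 0`) a present
  FC class of pattern `0000` with ORBIT SIGN `s` AND a present FC class of pattern `0011` with orbit sign `−s`, OR (odd core, `t := sign Im`) a
  present FC class of pattern `0001` with orbit sign `t` AND one of pattern `0111` with orbit sign `−t`. Here the ORBIT SIGN of an
  occurrence is `levelSign · sign cprod` (`levelSign` = `+1` on `lower` = N, `−1` on `upper` = P, the orientation of `MConfig.wch`).
* §3 THE ORBIT SIGN IS `G₁`-INTRINSIC ON EVEN WEIGHTS: `MCell.cprod_delta_even ∕ _odd` (Δ fixes `cprod` on axis cells of even parity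
  weight and negates it on odd ones — from (J)'s `cprod_delta`: the factor is `(−1)^{#real-phase factors} = (−1)^{4−|ρ|}`),
  `MCell.cprod_delta_iterate_even`, `MCell.cprod_g1_even` (`cprod (Δⁿ σ·Z) = cprod Z` for `|ρ(Z)|` even): so on a support whose two levels
  are `G₁`-closed the sign of §2 is constant along even-type `G₁`-orbits — RESULT 14's «one {0,4}-type orbit of sign s and one {2}-type
  orbit of sign −s» is exactly §2's conclusion read orbit-wise; on odd-type orbits the sign alternates with the weight (840: `+Im` at
  weight 1, `−Im` at weight 3), consistent with «one {1,3}-type orbit».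
* §4 probes (`decide`): the orbit sign of `[ℓ₁|ℓ₁|ℓ₁|ℓ₁]`, `[ℓ₁|ℓ₁|ℓ_i|ℓ_{−i}]` (pattern `0011`, cprod `−1`: opposite sign AT THE SAME
  LEVEL, the shape bc5-plan g6 l.32144 names `[6I+ℓ_ζ, 6I+ℓ_ζ, 6I+ℓ_{ζ′}, 6I+ℓ_{ζ″}]`), and Δ on them.

WHAT IS NOT HERE ∕ NOT IN LEAN. The static game (RULE D ∕ FC1 ∕ X± ∕ A∪2I±), hence no LINE 5 statement; `G1Rel`-phrased corollaries (one
line from §3 + (K) `pwt_of_g1Rel`, left to a sequel importing (K)); Burnside counts, encoders, SAT verdicts, the (H1) LP. The frame's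
identification with `H^{ev}(S⁴)` and of the screen with PAD4-FIRSTORDER §0's (A1)-target stays the cell's pencil modelling sentence (as for
840 ∕ (F) ∕ (J)). No variety, sheaf, σ, seed or abelian variety; NOTHING HERE SAYS THAT HC ∕ HC_CM ∕ HC_AV ∕ W₆ ∕ HC_Kum4Type HOLDS OR
FAILS. No `instance`, no notation, no named fact, 0 `sorry`.

SOURCES (sha16 ∕ bus): gs-eng-2 g51 RESULT 14 l.31979, LEMMA-FCCORE-gs2g51.md v1.3 eed5177b5e337200 §1 ∕ §1b ∕ Cor. 1 ∕ Cor. 1b;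
`Pad4FCCore.lean` 77cf033c04df8791 (p588880); (F) `Pad4TowerFCCoreSeam.lean` (p603640); (J) `Pad4TowerFCCoreParitySeam.lean`
7425de8587204214; (K) `Pad4TowerCleanCellOrbits.lean` cefc3ae11e84e18f (header: signs deferred); gs-eng-2 g52 READ-K R1 l.32197;
director-hodge g13 R13.2 (4) l.32130 ∕ l.32140; bc5-plan g6 attribution spec l.32144.
-/

namespace Summit.Ventures.HSemireg.Pad4Tower

open Finset

/-! ## §1 The quantitative parity form on axis cells (840's `fcCore_κ` through the seam) -/

/-- **`8·X_ρ = ± Re μ` ON THE EVEN PATTERNS** (axis cells, any integer multiplicities, (A1)): `+Re wch(ēēēē)` at `0000`, `1111`;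
`−Re wch(ēēēē)` at the six weight-2 patterns `0011, 0101, 0110, 1001, 1010, 1100`. -/
theorem MConfig.eight_xPat_re (C : MConfig) (mN mP : MCell → ℤ) (hN : ∀ Z ∈ C.lower, FCc Z → AxisCell Z)
    (hP : ∀ P ∈ C.upper, FCc P → AxisCell P) (hA : ClassScreen (C.wch mN mP)) :
    8 * C.xPat mN mP 0 = (C.wch mN mP ebarWord).re ∧ 8 * C.xPat mN mP 15 = (C.wch mN mP ebarWord).re ∧
      8 * C.xPat mN mP 3 = -(C.wch mN mP ebarWord).re ∧ 8 * C.xPat mN mP 5 = -(C.wch mN mP ebarWord).re ∧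
      8 * C.xPat mN mP 6 = -(C.wch mN mP ebarWord).re ∧ 8 * C.xPat mN mP 9 = -(C.wch mN mP ebarWord).re ∧
      8 * C.xPat mN mP 10 = -(C.wch mN mP ebarWord).re ∧ 8 * C.xPat mN mP 12 = -(C.wch mN mP ebarWord).re := by
  have h := C.mixedRowsVanish_of_classScreen_axis mN mP hN hP hA
  obtain ⟨hre, -⟩ := C.mu_fcCore_axis mN mP hN hP
  have e0 := Pad4FCCore.fcCore_00 _ h
  have e15 := Pad4FCCore.fcCore_15 _ h
  have e3 := Pad4FCCore.fcCore_03 _ h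
  have e5 := Pad4FCCore.fcCore_05 _ h
  have e6 := Pad4FCCore.fcCore_06 _ h
  have e9 := Pad4FCCore.fcCore_09 _ h
  have e10 := Pad4FCCore.fcCore_10 _ h
  have e12 := Pad4FCCore.fcCore_12 _ h
  rw [hre] at e0 e15 e3 e5 e6 e9 e10 e12
  exact ⟨by exact_mod_cast e0, by exact_mod_cast e15, by exact_mod_cast e3, by exact_mod_cast e5, by exact_mod_cast e6,
    by exact_mod_cast e9, by exact_mod_cast e10, by exact_mod_cast e12⟩

/-- **`8·X_ρ = ± Im μ` ON THE ODD PATTERNS**: `+Im wch(ēēēē)` at the weight-1 patterns `0001, 0010, 0100, 1000`; `−Im wch(ēēēē)` at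
the weight-3 patterns `0111, 1011, 1101, 1110`. -/
theorem MConfig.eight_xPat_im (C : MConfig) (mN mP : MCell → ℤ) (hN : ∀ Z ∈ C.lower, FCc Z → AxisCell Z)
    (hP : ∀ P ∈ C.upper, FCc P → AxisCell P) (hA : ClassScreen (C.wch mN mP)) :
    8 * C.xPat mN mP 1 = (C.wch mN mP ebarWord).im ∧ 8 * C.xPat mN mP 2 = (C.wch mN mP ebarWord).im ∧
      8 * C.xPat mN mP 4 = (C.wch mN mP ebarWord).im ∧ 8 * C.xPat mN mP 8 = (C.wch mN mP ebarWord).im ∧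
      8 * C.xPat mN mP 7 = -(C.wch mN mP ebarWord).im ∧ 8 * C.xPat mN mP 11 = -(C.wch mN mP ebarWord).im ∧
      8 * C.xPat mN mP 13 = -(C.wch mN mP ebarWord).im ∧ 8 * C.xPat mN mP 14 = -(C.wch mN mP ebarWord).im := by
  have h := C.mixedRowsVanish_of_classScreen_axis mN mP hN hP hA
  obtain ⟨-, him⟩ := C.mu_fcCore_axis mN mP hN hP
  have e1 := Pad4FCCore.fcCore_01 _ h
  have e2 := Pad4FCCore.fcCore_02 _ h
  have e4 := Pad4FCCore.fcCore_04 _ h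
  have e8 := Pad4FCCore.fcCore_08 _ h
  have e7 := Pad4FCCore.fcCore_07 _ h
  have e11 := Pad4FCCore.fcCore_11 _ h
  have e13 := Pad4FCCore.fcCore_13 _ h
  have e14 := Pad4FCCore.fcCore_14 _ h
  rw [him] at e1 e2 e4 e8 e7 e11 e13 e14
  exact ⟨by exact_mod_cast e1, by exact_mod_cast e2, by exact_mod_cast e4, by exact_mod_cast e8, by exact_mod_cast e7,
    by exact_mod_cast e11, by exact_mod_cast e13, by exact_mod_cast e14⟩

/-! ## §2 Signed presence for positive multiplicities -/

/-- **A POSITIVE AGGREGATE HAS A POSITIVE TERM**: with multiplicities `≥ 1` (here: `> 0` on the support), `xPat κ > 0` forces a LOWER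
(`N`) class of pattern `κ` with `cprod > 0` or an UPPER (`P`) class of pattern `κ` with `cprod < 0` — an occurrence of ORBIT SIGN `+1`
(`levelSign · sign cprod`, `levelSign = +1 ∕ −1` on `lower ∕ upper`, the orientation of `MConfig.wch`). -/
theorem MConfig.exists_signed_of_xPat_pos (C : MConfig) (mN mP : MCell → ℤ) (hmN : ∀ Z ∈ C.lower, 0 < mN Z)
    (hmP : ∀ P ∈ C.upper, 0 < mP P) (κ : Fin 16) (h : 0 < C.xPat mN mP κ) :
    (∃ Z ∈ C.lower, FCc Z ∧ Z.pat = κ ∧ 0 < Z.cprod) ∨ (∃ P ∈ C.upper, FCc P ∧ P.pat = κ ∧ P.cprod < 0) := by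
  by_contra hno
  push Not at hno
  obtain ⟨hl, hu⟩ := hno
  have h1 : ∑ Z ∈ C.lower.filter (fun Z => FCc Z ∧ Z.pat = κ), mN Z * Z.cprod ≤ 0 :=
    Finset.sum_nonpos fun Z hZ => by
      obtain ⟨hZl, hfc, hp⟩ := Finset.mem_filter.1 hZ
      exact mul_nonpos_of_nonneg_of_nonpos (le_of_lt (hmN Z hZl)) (hl Z hZl hfc hp)
  have h2 : 0 ≤ ∑ P ∈ C.upper.filter (fun P => FCc P ∧ P.pat = κ), mP P * P.cprod :=
    Finset.sum_nonneg fun P hPm => by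
      obtain ⟨hPu, hfc, hp⟩ := Finset.mem_filter.1 hPm
      exact mul_nonneg (le_of_lt (hmP P hPu)) (hu P hPu hfc hp)
  have : C.xPat mN mP κ ≤ 0 := by unfold MConfig.xPat; omega
  omega

/-- … and a NEGATIVE aggregate has a term of orbit sign `−1` (a lower class with `cprod < 0` or an upper class with `cprod > 0`). -/
theorem MConfig.exists_signed_of_xPat_neg (C : MConfig) (mN mP : MCell → ℤ) (hmN : ∀ Z ∈ C.lower, 0 < mN Z)
    (hmP : ∀ P ∈ C.upper, 0 < mP P) (κ : Fin 16) (h : C.xPat mN mP κ < 0) :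
    (∃ Z ∈ C.lower, FCc Z ∧ Z.pat = κ ∧ Z.cprod < 0) ∨ (∃ P ∈ C.upper, FCc P ∧ P.pat = κ ∧ 0 < P.cprod) := by
  by_contra hno
  push Not at hno
  obtain ⟨hl, hu⟩ := hno
  have h1 : 0 ≤ ∑ Z ∈ C.lower.filter (fun Z => FCc Z ∧ Z.pat = κ), mN Z * Z.cprod :=
    Finset.sum_nonneg fun Z hZ => by
      obtain ⟨hZl, hfc, hp⟩ := Finset.mem_filter.1 hZ
      exact mul_nonneg (le_of_lt (hmN Z hZl)) (hl Z hZl hfc hp)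
  have h2 : ∑ P ∈ C.upper.filter (fun P => FCc P ∧ P.pat = κ), mP P * P.cprod ≤ 0 :=
    Finset.sum_nonpos fun P hPm => by
      obtain ⟨hPu, hfc, hp⟩ := Finset.mem_filter.1 hPm
      exact mul_nonpos_of_nonneg_of_nonpos (le_of_lt (hmP P hPu)) (hu P hPu hfc hp)
  have : 0 ≤ C.xPat mN mP κ := by unfold MConfig.xPat; omega
  omega

/-- a present fully charged occurrence of pattern `κ` with ORBIT SIGN `s` (`s = ±1`): a lower class with `sign cprod = s` or an upper
class with `sign cprod = −s`. -/
def MConfig.HasSignedFC (C : MConfig) (κ : Fin 16) (s : ℤ) : Prop :=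
  (∃ Z ∈ C.lower, FCc Z ∧ Z.pat = κ ∧ Z.cprod.sign = s) ∨ (∃ P ∈ C.upper, FCc P ∧ P.pat = κ ∧ P.cprod.sign = -s)

/-- the sign of a non-zero aggregate is carried by an occurrence of the same orbit sign. -/
theorem MConfig.hasSignedFC_of_xPat_ne (C : MConfig) (mN mP : MCell → ℤ) (hmN : ∀ Z ∈ C.lower, 0 < mN Z)
    (hmP : ∀ P ∈ C.upper, 0 < mP P) (κ : Fin 16) (h : C.xPat mN mP κ ≠ 0) :
    C.HasSignedFC κ (C.xPat mN mP κ).sign := by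
  rcases lt_or_gt_of_ne h with hneg | hpos
  · rw [Int.sign_eq_neg_one_of_neg hneg]
    rcases C.exists_signed_of_xPat_neg mN mP hmN hmP κ hneg with ⟨Z, hZ, hfc, hp, hc⟩ | ⟨P, hPu, hfc, hp, hc⟩
    · exact Or.inl ⟨Z, hZ, hfc, hp, Int.sign_eq_neg_one_of_neg hc⟩
    · exact Or.inr ⟨P, hPu, hfc, hp, by rw [Int.sign_eq_one_of_pos hc]; norm_num⟩
  · rw [Int.sign_eq_one_of_pos hpos]
    rcases C.exists_signed_of_xPat_pos mN mP hmN hmP κ hpos with ⟨Z, hZ, hfc, hp, hc⟩ | ⟨P, hPu, hfc, hp, hc⟩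
    · exact Or.inl ⟨Z, hZ, hfc, hp, Int.sign_eq_one_of_pos hc⟩
    · exact Or.inr ⟨P, hPu, hfc, hp, by rw [Int.sign_eq_neg_one_of_neg hc]⟩

/-- if `8·x = y` then `x` and `y` have the same sign; if `8·x = −y` then opposite signs. -/
theorem sign_of_eight_mul (x y : ℤ) : (8 * x = y → x.sign = y.sign) ∧ (8 * x = -y → x.sign = -y.sign) := by
  have h8 : Int.sign 8 = 1 := by decide
  constructor
  · rintro rfl
    rw [Int.sign_mul, h8, one_mul]
  · intro h
    have e : y = -(8 * x) := by omega
    rw [e, Int.sign_neg, Int.sign_mul, h8, one_mul, neg_neg]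

/-- **KERNEL RESULT 14 WITH SIGNS — THE SIGNED FC CORE.** Let the fully charged classes of `C` be axis cells, the multiplicities be
positive on the support, the weighted class tensor pass (A1), and `μ = wch(eeee) ≠ 0`. Then EITHER (even core: `s := sign Re wch(ēēēē)`,
`s ≠ 0`) `C` has a present FC occurrence of pattern `0000` (weight 0, orbit type {0,4}) with orbit sign `s` AND one of pattern `0011`
(weight 2, orbit type {2}) with orbit sign `−s`; OR (odd core: `t := sign Im wch(ēēēē)`, `t ≠ 0`) an occurrence of pattern `0001`
(weight 1) with orbit sign `t` AND one of pattern `0111` (weight 3) with orbit sign `−t`. (gs-eng-2 g51 RESULT 14; LEMMA FC-CORE Cor. 1 ∕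
Cor. 1b presence form with levels and antipodal signs.) -/
theorem MConfig.signed_fcCore_of_classScreen (C : MConfig) (mN mP : MCell → ℤ) (hN : ∀ Z ∈ C.lower, FCc Z → AxisCell Z)
    (hP : ∀ P ∈ C.upper, FCc P → AxisCell P) (hmN : ∀ Z ∈ C.lower, 0 < mN Z) (hmP : ∀ P ∈ C.upper, 0 < mP P)
    (hA : ClassScreen (C.wch mN mP)) (hμ : C.wch mN mP eWord ≠ 0) :
    ((C.wch mN mP ebarWord).re.sign ≠ 0 ∧ C.HasSignedFC 0 (C.wch mN mP ebarWord).re.sign ∧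
        C.HasSignedFC 3 (-(C.wch mN mP ebarWord).re.sign)) ∨
      ((C.wch mN mP ebarWord).im.sign ≠ 0 ∧ C.HasSignedFC 1 (C.wch mN mP ebarWord).im.sign ∧
        C.HasSignedFC 7 (-(C.wch mN mP ebarWord).im.sign)) := by
  have hμ' : C.wch mN mP ebarWord ≠ 0 := (C.wch_ebarWord_ne_zero_iff mN mP).2 hμ
  obtain ⟨e0, -, e3, -⟩ := C.eight_xPat_re mN mP hN hP hA
  obtain ⟨e1, -, -, -, e7, -⟩ := C.eight_xPat_im mN mP hN hP hA
  by_cases hre : (C.wch mN mP ebarWord).re = 0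
  · -- odd core
    have him : (C.wch mN mP ebarWord).im ≠ 0 := fun him => hμ' (Zsqrtd.ext hre him)
    refine Or.inr ⟨fun h0 => him (Int.sign_eq_zero_iff_zero.1 h0), ?_, ?_⟩
    · have hx : C.xPat mN mP 1 ≠ 0 := fun h0 => him (by rw [← e1, h0]; norm_num)
      have := C.hasSignedFC_of_xPat_ne mN mP hmN hmP 1 hx
      rwa [(sign_of_eight_mul _ _).1 e1] at this
    · have hx : C.xPat mN mP 7 ≠ 0 := fun h0 => him (by have := e7; rw [h0] at this; omega)
      have := C.hasSignedFC_of_xPat_ne mN mP hmN hmP 7 hx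
      rwa [(sign_of_eight_mul _ _).2 e7] at this
  · -- even core
    refine Or.inl ⟨fun h0 => hre (Int.sign_eq_zero_iff_zero.1 h0), ?_, ?_⟩
    · have hx : C.xPat mN mP 0 ≠ 0 := fun h0 => hre (by rw [← e0, h0]; norm_num)
      have := C.hasSignedFC_of_xPat_ne mN mP hmN hmP 0 hx
      rwa [(sign_of_eight_mul _ _).1 e0] at this
    · have hx : C.xPat mN mP 3 ≠ 0 := fun h0 => hre (by have := e3; rw [h0] at this; omega)
      have := C.hasSignedFC_of_xPat_ne mN mP hmN hmP 3 hx
      rwa [(sign_of_eight_mul _ _).2 e3] at this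

/-- the same presence holds at EVERY pattern of the active core: all eight even patterns carry signed occurrences (`s` at `0000`,
`1111`; `−s` at the six weight-2 patterns) when `Re wch(ēēēē) ≠ 0`, and all eight odd ones (`t` at weight 1, `−t` at weight 3) when
`Im wch(ēēēē) ≠ 0` (LEMMA FC-CORE Cor. 1b, signed). -/
theorem MConfig.signed_presence_all (C : MConfig) (mN mP : MCell → ℤ) (hN : ∀ Z ∈ C.lower, FCc Z → AxisCell Z)
    (hP : ∀ P ∈ C.upper, FCc P → AxisCell P) (hmN : ∀ Z ∈ C.lower, 0 < mN Z) (hmP : ∀ P ∈ C.upper, 0 < mP P)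
    (hA : ClassScreen (C.wch mN mP)) :
    let s := (C.wch mN mP ebarWord).re.sign
    let t := (C.wch mN mP ebarWord).im.sign
    ((C.wch mN mP ebarWord).re ≠ 0 → C.HasSignedFC 0 s ∧ C.HasSignedFC 15 s ∧ C.HasSignedFC 3 (-s) ∧ C.HasSignedFC 5 (-s) ∧
        C.HasSignedFC 6 (-s) ∧ C.HasSignedFC 9 (-s) ∧ C.HasSignedFC 10 (-s) ∧ C.HasSignedFC 12 (-s)) ∧
      ((C.wch mN mP ebarWord).im ≠ 0 → C.HasSignedFC 1 t ∧ C.HasSignedFC 2 t ∧ C.HasSignedFC 4 t ∧ C.HasSignedFC 8 t ∧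
        C.HasSignedFC 7 (-t) ∧ C.HasSignedFC 11 (-t) ∧ C.HasSignedFC 13 (-t) ∧ C.HasSignedFC 14 (-t)) := by
  intro s t
  obtain ⟨e0, e15, e3, e5, e6, e9, e10, e12⟩ := C.eight_xPat_re mN mP hN hP hA
  obtain ⟨e1, e2, e4, e8, e7, e11, e13, e14⟩ := C.eight_xPat_im mN mP hN hP hA
  have P : ∀ (κ : Fin 16) (y : ℤ), y ≠ 0 → 8 * C.xPat mN mP κ = y → C.HasSignedFC κ y.sign := fun κ y hy e => by
    have hx : C.xPat mN mP κ ≠ 0 := fun h0 => hy (by rw [← e, h0]; norm_num)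
    have := C.hasSignedFC_of_xPat_ne mN mP hmN hmP κ hx
    rwa [(sign_of_eight_mul _ _).1 e] at this
  have M : ∀ (κ : Fin 16) (y : ℤ), y ≠ 0 → 8 * C.xPat mN mP κ = -y → C.HasSignedFC κ (-y.sign) := fun κ y hy e => by
    have hx : C.xPat mN mP κ ≠ 0 := fun h0 => hy (by have := e; rw [h0] at this; omega)
    have := C.hasSignedFC_of_xPat_ne mN mP hmN hmP κ hx
    rwa [(sign_of_eight_mul _ _).2 e] at this
  exact ⟨fun h => ⟨P 0 _ h e0, P 15 _ h e15, M 3 _ h e3, M 5 _ h e5, M 6 _ h e6, M 9 _ h e9, M 10 _ h e10, M 12 _ h e12⟩,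
    fun h => ⟨P 1 _ h e1, P 2 _ h e2, P 4 _ h e4, P 8 _ h e8, M 7 _ h e7, M 11 _ h e11, M 13 _ h e13, M 14 _ h e14⟩⟩

/-! ## §3 The orbit sign is `G₁`-intrinsic on even parity weights -/

/-- the number of real-phase factors of an axis cell is `4 − |ρ|`; hence the Δ-factor of (J)'s `cprod_delta` is `(−1)^{4−|ρ|}`:
**Δ FIXES the signed charge product on EVEN parity weight**. -/
theorem MCell.cprod_delta_even (Z : MCell) (hZ : AxisCell Z) (he : pwt Z.pat % 2 = 0) : Z.delta.cprod = Z.cprod := by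
  rw [Z.cprod_delta hZ]
  have h0 := kbit_le_one (Z 0); have h1 := kbit_le_one (Z 1); have h2 := kbit_le_one (Z 2); have h3 := kbit_le_one (Z 3)
  have hw : (kbit (Z 0) + kbit (Z 1) + kbit (Z 2) + kbit (Z 3)) % 2 = 0 := by
    rw [pwt, bitOf_pat, bitOf_pat, bitOf_pat, bitOf_pat] at he; exact he
  rcases Nat.le_one_iff_eq_zero_or_eq_one.1 h0 with a | a <;> rcases Nat.le_one_iff_eq_zero_or_eq_one.1 h1 with b | b <;>
    rcases Nat.le_one_iff_eq_zero_or_eq_one.1 h2 with c | c <;> rcases Nat.le_one_iff_eq_zero_or_eq_one.1 h3 with d | d <;>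
    simp only [a, b, c, d] at hw ⊢ <;> first | (exfalso; omega) | norm_num

/-- … and **NEGATES it on ODD parity weight** (840: `+Im μ` at weight 1, `−Im μ` at weight 3 — the same orbit, opposite signs). -/
theorem MCell.cprod_delta_odd (Z : MCell) (hZ : AxisCell Z) (ho : pwt Z.pat % 2 = 1) : Z.delta.cprod = -Z.cprod := by
  rw [Z.cprod_delta hZ]
  have h0 := kbit_le_one (Z 0); have h1 := kbit_le_one (Z 1); have h2 := kbit_le_one (Z 2); have h3 := kbit_le_one (Z 3)
  have hw : (kbit (Z 0) + kbit (Z 1) + kbit (Z 2) + kbit (Z 3)) % 2 = 1 := by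
    rw [pwt, bitOf_pat, bitOf_pat, bitOf_pat, bitOf_pat] at ho; exact ho
  rcases Nat.le_one_iff_eq_zero_or_eq_one.1 h0 with a | a <;> rcases Nat.le_one_iff_eq_zero_or_eq_one.1 h1 with b | b <;>
    rcases Nat.le_one_iff_eq_zero_or_eq_one.1 h2 with c | c <;> rcases Nat.le_one_iff_eq_zero_or_eq_one.1 h3 with d | d <;>
    simp only [a, b, c, d] at hw ⊢ <;> first | (exfalso; omega) | norm_num

/-- Δ preserves axis cells (local copy of the (K) fact, to keep this file's import at (J)). -/
theorem MCell.axisCell_delta' (Z : MCell) (hZ : AxisCell Z) : AxisCell Z.delta := fun f => by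
  rcases hZ f with ⟨h1, h2⟩ | ⟨h1, h2⟩
  · exact Or.inr ⟨by simp [MCell.delta, deltaPt, h2], by simpa [MCell.delta, deltaPt] using h1⟩
  · exact Or.inl ⟨by simpa [MCell.delta, deltaPt] using h2, by simp [MCell.delta, deltaPt, h1]⟩

/-- the parity of the parity weight is Δ-invariant on axis cells (`|ρ(ΔZ)| = 4 − |ρ(Z)|`). -/
theorem MCell.pwt_delta_mod_two (Z : MCell) (hZ : AxisCell Z) : pwt Z.delta.pat % 2 = pwt Z.pat % 2 := by
  have hb : ∀ f, bitOf Z.delta.pat f = 1 - bitOf Z.pat f := Z.bitOf_pat_delta hZ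
  have hle : ∀ f, bitOf Z.pat f ≤ 1 := fun f => by rw [bitOf_pat]; exact kbit_le_one _
  have h0 := hb 0; have h1 := hb 1; have h2 := hb 2; have h3 := hb 3
  have l0 := hle 0; have l1 := hle 1; have l2 := hle 2; have l3 := hle 3
  unfold pwt
  omega

/-- **iterating Δ on an even-weight axis cell fixes the signed charge product** (and keeps axis-ness and the weight parity). -/
theorem MCell.cprod_delta_iterate_even (n : ℕ) : ∀ Z : MCell, AxisCell Z → pwt Z.pat % 2 = 0 →
    AxisCell (MCell.delta^[n] Z) ∧ pwt (MCell.delta^[n] Z).pat % 2 = 0 ∧ (MCell.delta^[n] Z).cprod = Z.cprod := by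
  induction n with
  | zero => intro Z hZ he; exact ⟨hZ, he, rfl⟩
  | succ n ih =>
    intro Z hZ he
    obtain ⟨hax, hev, hc⟩ := ih Z hZ he
    rw [Function.iterate_succ_apply']
    exact ⟨MCell.axisCell_delta' _ hax, by rw [MCell.pwt_delta_mod_two _ hax]; exact hev,
      by rw [MCell.cprod_delta_even _ hax hev, hc]⟩

/-- **THE ORBIT SIGN IS `G₁ = ⟨Δ⟩ × S₄`-INTRINSIC ON EVEN WEIGHTS**: `cprod (Δⁿ (σ·Z)) = cprod Z` for every factor permutation `σ`,
every `n`, and every axis cell `Z` of even parity weight ((J) `kbit_cprod_perm` + §3). Hence on a support whose two levels are `G₁`-closed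
the signed occurrences of §2 come in whole `G₁`-orbits of ONE sign each: RESULT 14's «one {0,4}-type FC orbit of sign `s` AND one
{2}-type FC orbit of sign `−s`». -/
theorem MCell.cprod_g1_even (σ : Equiv.Perm (Fin 4)) (n : ℕ) (Z : MCell) (hZ : AxisCell Z) (he : pwt Z.pat % 2 = 0) :
    (MCell.delta^[n] (Z.perm σ)).cprod = Z.cprod := by
  have hax : AxisCell (Z.perm σ) := fun f => hZ (σ f)
  have hpw : pwt (Z.perm σ).pat % 2 = 0 := by
    have e : pwt (Z.perm σ).pat = pwt Z.pat := by
      rw [pwt, pwt, (Z.kbit_cprod_perm σ).1, (Z.kbit_cprod_perm σ).1, (Z.kbit_cprod_perm σ).1, (Z.kbit_cprod_perm σ).1,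
        bitOf_pat, bitOf_pat, bitOf_pat, bitOf_pat, bitOf_pat, bitOf_pat, bitOf_pat, bitOf_pat]
      have : kbit (Z (σ 0)) + kbit (Z (σ 1)) + kbit (Z (σ 2)) + kbit (Z (σ 3)) = ∑ f, kbit (Z (σ f)) := by
        simp [Fin.sum_univ_four]
      rw [this, Equiv.sum_comp σ (fun f => kbit (Z f))]
      simp [Fin.sum_univ_four]
    rw [e]; exact he
  rw [(MCell.cprod_delta_iterate_even n (Z.perm σ) hax hpw).2.2, (Z.kbit_cprod_perm σ).2]

/-! ## §4 Kernel probes -/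

/-- `[ℓ₁|ℓ₁|ℓ₁|ℓ₁]` (pattern `0000`) has `cprod = +1`; the SAME-LEVEL cell `[ℓ₁|ℓ₁|ℓ_i|ℓ_{−i}]` (pattern `0011`, weight 2) has
`cprod = −1` — opposite orbit sign at equal level, the shape «[6I+ℓ_ζ, 6I+ℓ_ζ, 6I+ℓ_{ζ′}, 6I+ℓ_{ζ″}]» of bc5-plan g6's reading key
l.32144 up to the common apex; Δ fixes both products; on the weight-1 cell `[ℓ₁|ℓ₁|ℓ₁|ℓ_i]` Δ negates it. [kernel, `decide`] -/
theorem sign_probe :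
    (mcellOf (lpt 1 0) (lpt 1 0) (lpt 1 0) (lpt 1 0)).cprod = 1 ∧ (mcellOf (lpt 1 0) (lpt 1 0) (lpt 1 1) (lpt 1 3)).pat = 3 ∧
      (mcellOf (lpt 1 0) (lpt 1 0) (lpt 1 1) (lpt 1 3)).cprod = -1 ∧
      (mcellOf (lpt 1 0) (lpt 1 0) (lpt 1 1) (lpt 1 3)).delta.cprod = -1 ∧
      (mcellOf (lpt 1 0) (lpt 1 0) (lpt 1 0) (lpt 1 0)).delta.cprod = 1 ∧
      (mcellOf (lpt 1 0) (lpt 1 0) (lpt 1 0) (lpt 1 1)).pat = 1 ∧ (mcellOf (lpt 1 0) (lpt 1 0) (lpt 1 0) (lpt 1 1)).cprod = 1 ∧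
      (mcellOf (lpt 1 0) (lpt 1 0) (lpt 1 0) (lpt 1 1)).delta.cprod = -1 := by
  decide +kernel

end Summit.Ventures.HSemireg.Pad4Tower
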